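import Mathlib.Data.Sym.Sym2
import Literature.Probability.RandomPlanarGeometry.USTPeanoLattice
import HarnessLib

/-!
# Combinatorics of the Manhattan lattice: the two steps from a Peano vertex ([LSW04] §4.1)

G. F. Lawler, O. Schramm, W. Werner, Ann. Probab. **32** (2004) (**[LSW04]**), §4.1, p. 971:
"there are precisely two oriented edges of `G⃗` with initial point `v`, say `e₁` and `e₂`, where
one of these, say `e₁`, intersects an edge `f₁` of the primal grid `ℤ²`, and the other intersects
an edge `f₂` of the dual grid `(1/2 + ℤ)²`. Note also that `f₁ ∩ f₂ ≠ ∅`."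

This file is the index arithmetic behind this sentence (no topology, no probability), used in
the proof that every `D ∈ 𝔇*` has a Peano path. For a Peano index `p`
(`peanoPt p = (1/4 + p₁/2, 1/4 + p₂/2)`):

* `stepP p`, `stepD p` — the two Manhattan out-neighbours of `p`: the edge `p → stepP p` crosses
  the PRIMAL edge `f₁ = [primalNbr p, farP p]`, the edge `p → stepD p` crosses the DUAL edge
  `f₂ = [dualNbr p, farD p]` (`manhattan_iff_step`; the geometric meaning of "crosses" is
  established in `USTPeanoSegments.lean`); crossing a primal edge keeps the primal neighbour
  (`primalNbr_stepP`), crossing a dual edge keeps the dual neighbour (`dualNbr_stepD`);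
* `coSrc p` — the other Peano vertex whose out-edges cross `f₁` and `f₂` (the vertex opposite to
  `p` in the square face of `G` centred at `f₁ ∩ f₂`): the in-neighbours of `stepP p` and of
  `stepD p` are exactly `p` and `coSrc p` (`manhattan_to_stepP_iff`, `manhattan_to_stepD_iff`);
* the square faces: `stepP^[4] = id` around the primal vertex `primalNbr p` (clockwise) and
  `stepD^[4] = id` around `dualNbr p`, crossing four distinct spokes (`farP_stepP_ne`, …);
* `IsDualPair u u' w w'` — the primal edge `[u, u']` and the dual edge `[w, w']` are dual to each
  other (both are lattice edges and their midpoints coincide); `f₁`, `f₂` are such a pair and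
  determine each other (`isDualPair_far`, `IsDualPair.eq_of_dual`, `IsDualPair.eq_of_primal`);
* `swapIdx (m, n) = (-n, -m)` — ONE formula which, read on Peano, primal and dual indices
  alike, is the reflection of the plane in the line `x + y = 1/2`: it exchanges the primal and
  the dual grid and preserves the Manhattan orientation (`manhattan_swapIdx`, `stepP_swapIdx`, …),
  so that every statement about primal crossings has a dual twin.

All proofs are the same: split `p = (2m + r, 2n + s)`, `r, s ∈ {0, 1}` (`parity_cases`),
normalise with the `simp` lemmas of §"Normal forms", finish with `omega`.
-/

namespace Literature.Probability.RandomPlanarGeometry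

namespace USTPeano

/-! ### The two out-neighbours -/

/-- The horizontal Manhattan out-neighbour of `p` (the row `p₂` points towards `+x` iff `p₂` is
even). [cite: LawlerSchrammWerner2004, §4.1] -/
def hStep (p : ℤ × ℤ) : ℤ × ℤ := if p.2 % 2 = 0 then (p.1 + 1, p.2) else (p.1 - 1, p.2)

/-- The vertical Manhattan out-neighbour of `p` (the column `p₁` points towards `+y` iff `p₁` is
odd). [cite: LawlerSchrammWerner2004, §4.1] -/
def vStep (p : ℤ × ℤ) : ℤ × ℤ := if p.1 % 2 = 0 then (p.1, p.2 - 1) else (p.1, p.2 + 1)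

/-- **The out-neighbour across a primal edge**: the endpoint of the Manhattan edge `e₁` from `p`
which intersects an edge of the primal grid (the vertical step iff `p₁ + p₂` is even).
[cite: LawlerSchrammWerner2004, §4.1] -/
def stepP (p : ℤ × ℤ) : ℤ × ℤ := if (p.1 + p.2) % 2 = 0 then vStep p else hStep p

/-- **The out-neighbour across a dual edge**: the endpoint of the Manhattan edge `e₂` from `p`
which intersects an edge of the dual grid. [cite: LawlerSchrammWerner2004, §4.1] -/
def stepD (p : ℤ × ℤ) : ℤ × ℤ := if (p.1 + p.2) % 2 = 0 then hStep p else vStep p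

/-- The far endpoint of the primal edge `f₁ = [primalNbr p, farP p]` crossed by `p → stepP p`:
the primal neighbour of the other out-neighbour. [cite: LawlerSchrammWerner2004, §4.1] -/
def farP (p : ℤ × ℤ) : ℤ × ℤ := primalNbr (stepD p)

/-- The far endpoint of the dual edge `f₂ = [dualNbr p, farD p]` crossed by `p → stepD p`.
[cite: LawlerSchrammWerner2004, §4.1] -/
def farD (p : ℤ × ℤ) : ℤ × ℤ := dualNbr (stepP p)

/-- **The co-source** of `p`: the Peano vertex opposite to `p` in the square face of `G` centred
at `f₁ ∩ f₂` (the reflection of `p` in that point); its two out-edges cross the same `f₁`, `f₂`.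
[cite: LawlerSchrammWerner2004, §4.1] -/
def coSrc (p : ℤ × ℤ) : ℤ × ℤ :=
  (2 * (primalNbr p).1 + 2 * (farP p).1 - p.1 - 1, 2 * (primalNbr p).2 + 2 * (farP p).2 - p.2 - 1)

/-- **The primal/dual exchange** `(m, n) ↦ (-n, -m)`: read on Peano, primal and dual indices it
is the reflection of `ℂ` in the line `x + y = 1/2`, which maps `ℤ²` onto `(1/2 + ℤ)²` and
preserves the Manhattan orientation. [folklore] -/
def swapIdx (p : ℤ × ℤ) : ℤ × ℤ := (-p.2, -p.1)

/-- **Dual pairs of edges**: the primal edge `[u, u']` (lattice-adjacent primal indices) and the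
dual edge `[w, w']` (lattice-adjacent dual indices) are dual to each other, i.e. intersect (in
their common midpoint): `primalPt u + primalPt u' = dualPt w + dualPt w'`, which on indices reads
`u + u' = w + w' + (1, 1)`. [cite: LawlerSchrammWerner2004, §4.1] -/
def IsDualPair (u u' w w' : ℤ × ℤ) : Prop :=
  LatticeAdj u u' ∧ LatticeAdj w w' ∧ u.1 + u'.1 = w.1 + w'.1 + 1 ∧ u.2 + u'.2 = w.2 + w'.2 + 1

/-- `IsDualPair` is decidable. [folklore] -/
instance (u u' w w' : ℤ × ℤ) : Decidable (IsDualPair u u' w w') := by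
  unfold IsDualPair; infer_instance

/-! ### Normal forms on the four parity classes -/

section NormalForms

variable (m n : ℤ)

/-- Normal forms, class (even, even). [folklore] -/
@[simp] theorem stepP_ee : stepP (2 * m, 2 * n) = (2 * m, 2 * (n - 1) + 1) := by
  simp only [stepP, vStep, hStep]
  split_ifs <;> simp only [Prod.mk.injEq, true_and] <;> omega

/-- Normal forms, class (even, odd). [folklore] -/
@[simp] theorem stepP_eo : stepP (2 * m, 2 * n + 1) = (2 * (m - 1) + 1, 2 * n + 1) := by
  simp only [stepP, vStep, hStep]
  split_ifs <;> simp only [Prod.mk.injEq, and_true] <;> omega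

/-- Normal forms, class (odd, even). [folklore] -/
@[simp] theorem stepP_oe : stepP (2 * m + 1, 2 * n) = (2 * (m + 1), 2 * n) := by
  simp only [stepP, vStep, hStep]
  split_ifs <;> simp only [Prod.mk.injEq, and_true] <;> omega

/-- Normal forms, class (odd, odd). [folklore] -/
@[simp] theorem stepP_oo : stepP (2 * m + 1, 2 * n + 1) = (2 * m + 1, 2 * (n + 1)) := by
  simp only [stepP, vStep, hStep]
  split_ifs <;> simp only [Prod.mk.injEq, true_and] <;> omega

/-- Normal forms, class (even, even). [folklore] -/
@[simp] theorem stepD_ee : stepD (2 * m, 2 * n) = (2 * m + 1, 2 * n) := by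
  simp only [stepD, vStep, hStep]
  split_ifs <;> simp only [Prod.mk.injEq, and_true] <;> omega

/-- Normal forms, class (even, odd). [folklore] -/
@[simp] theorem stepD_eo : stepD (2 * m, 2 * n + 1) = (2 * m, 2 * n) := by
  simp only [stepD, vStep, hStep]
  split_ifs <;> simp only [Prod.mk.injEq, true_and] <;> omega

/-- Normal forms, class (odd, even). [folklore] -/
@[simp] theorem stepD_oe : stepD (2 * m + 1, 2 * n) = (2 * m + 1, 2 * n + 1) := by
  simp only [stepD, vStep, hStep]
  split_ifs <;> simp only [Prod.mk.injEq, true_and] <;> omega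

/-- Normal forms, class (odd, odd). [folklore] -/
@[simp] theorem stepD_oo : stepD (2 * m + 1, 2 * n + 1) = (2 * m, 2 * n + 1) := by
  simp only [stepD, vStep, hStep]
  split_ifs <;> simp only [Prod.mk.injEq, and_true] <;> omega

/-- Normal forms of the primal neighbour. [folklore] -/
@[simp] theorem primalNbr_ee : primalNbr (2 * m, 2 * n) = (m, n) := by
  simp only [primalNbr, Prod.mk.injEq]; omega

/-- Normal forms of the primal neighbour. [folklore] -/
@[simp] theorem primalNbr_eo : primalNbr (2 * m, 2 * n + 1) = (m, n + 1) := by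
  simp only [primalNbr, Prod.mk.injEq]; omega

/-- Normal forms of the primal neighbour. [folklore] -/
@[simp] theorem primalNbr_oe : primalNbr (2 * m + 1, 2 * n) = (m + 1, n) := by
  simp only [primalNbr, Prod.mk.injEq]; omega

/-- Normal forms of the primal neighbour. [folklore] -/
@[simp] theorem primalNbr_oo : primalNbr (2 * m + 1, 2 * n + 1) = (m + 1, n + 1) := by
  simp only [primalNbr, Prod.mk.injEq]; omega

/-- Normal forms of the dual neighbour. [folklore] -/
@[simp] theorem dualNbr_ee : dualNbr (2 * m, 2 * n) = (m, n) := by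
  simp only [dualNbr, Prod.mk.injEq]; omega

/-- Normal forms of the dual neighbour. [folklore] -/
@[simp] theorem dualNbr_eo : dualNbr (2 * m, 2 * n + 1) = (m, n) := by
  simp only [dualNbr, Prod.mk.injEq]; omega

/-- Normal forms of the dual neighbour. [folklore] -/
@[simp] theorem dualNbr_oe : dualNbr (2 * m + 1, 2 * n) = (m, n) := by
  simp only [dualNbr, Prod.mk.injEq]; omega

/-- Normal forms of the dual neighbour. [folklore] -/
@[simp] theorem dualNbr_oo : dualNbr (2 * m + 1, 2 * n + 1) = (m, n) := by
  simp only [dualNbr, Prod.mk.injEq]; omega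

/-- Normal forms of `farP`. [folklore] -/
@[simp] theorem farP_ee : farP (2 * m, 2 * n) = (m + 1, n) := by simp [farP]

/-- Normal forms of `farP`. [folklore] -/
@[simp] theorem farP_eo : farP (2 * m, 2 * n + 1) = (m, n) := by simp [farP]

/-- Normal forms of `farP`. [folklore] -/
@[simp] theorem farP_oe : farP (2 * m + 1, 2 * n) = (m + 1, n + 1) := by simp [farP]

/-- Normal forms of `farP`. [folklore] -/
@[simp] theorem farP_oo : farP (2 * m + 1, 2 * n + 1) = (m, n + 1) := by simp [farP]

/-- Normal forms of `farD`. [folklore] -/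
@[simp] theorem farD_ee : farD (2 * m, 2 * n) = (m, n - 1) := by simp [farD]

/-- Normal forms of `farD`. [folklore] -/
@[simp] theorem farD_eo : farD (2 * m, 2 * n + 1) = (m - 1, n) := by simp [farD]

/-- Normal forms of `farD`. [folklore] -/
@[simp] theorem farD_oe : farD (2 * m + 1, 2 * n) = (m + 1, n) := by simp [farD]

/-- Normal forms of `farD`. [folklore] -/
@[simp] theorem farD_oo : farD (2 * m + 1, 2 * n + 1) = (m, n + 1) := by simp [farD]

/-- Normal forms of `coSrc`. [folklore] -/
@[simp] theorem coSrc_ee : coSrc (2 * m, 2 * n) = (2 * m + 1, 2 * (n - 1) + 1) := by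
  simp only [coSrc, primalNbr_ee, farP_ee, Prod.mk.injEq]; omega

/-- Normal forms of `coSrc`. [folklore] -/
@[simp] theorem coSrc_eo : coSrc (2 * m, 2 * n + 1) = (2 * (m - 1) + 1, 2 * n) := by
  simp only [coSrc, primalNbr_eo, farP_eo, Prod.mk.injEq]; omega

/-- Normal forms of `coSrc`. [folklore] -/
@[simp] theorem coSrc_oe : coSrc (2 * m + 1, 2 * n) = (2 * (m + 1), 2 * n + 1) := by
  simp only [coSrc, primalNbr_oe, farP_oe, Prod.mk.injEq]; omega

/-- Normal forms of `coSrc`. [folklore] -/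
@[simp] theorem coSrc_oo : coSrc (2 * m + 1, 2 * n + 1) = (2 * m, 2 * (n + 1)) := by
  simp only [coSrc, primalNbr_oo, farP_oo, Prod.mk.injEq]; omega

end NormalForms

/-- Case split of a lattice index into the four parity classes, in the normal form used by the
`simp` set. [folklore] -/
theorem parity_cases (p : ℤ × ℤ) : ∃ m n : ℤ, p = (2 * m, 2 * n) ∨ p = (2 * m, 2 * n + 1) ∨
    p = (2 * m + 1, 2 * n) ∨ p = (2 * m + 1, 2 * n + 1) := by
  obtain ⟨i, j⟩ := p
  obtain ⟨m, rfl | rfl⟩ := Int.even_or_odd' i <;> obtain ⟨n, rfl | rfl⟩ := Int.even_or_odd' j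
  · exact ⟨m, n, Or.inl rfl⟩
  · exact ⟨m, n, Or.inr (Or.inl rfl)⟩
  · exact ⟨m, n, Or.inr (Or.inr (Or.inl rfl))⟩
  · exact ⟨m, n, Or.inr (Or.inr (Or.inr rfl))⟩

/-! ### The two steps are the Manhattan edges -/

/-- **Out-degree two**: the Manhattan out-neighbours of `p` are `stepD p` and `stepP p`.
[cite: LawlerSchrammWerner2004, §4.1] -/
theorem manhattan_iff_step (p q : ℤ × ℤ) : Manhattan p q ↔ q = stepD p ∨ q = stepP p := by
  rw [manhattan_iff]
  simp only [Int.even_iff]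
  obtain ⟨i, j⟩ := q
  obtain ⟨m, n, rfl | rfl | rfl | rfl⟩ := parity_cases p <;>
    simp only [stepD_ee, stepD_eo, stepD_oe, stepD_oo, stepP_ee, stepP_eo, stepP_oe, stepP_oo] <;>
      split_ifs <;> simp only [Prod.mk.injEq] <;> omega

/-- `p → stepP p` is a Manhattan edge. [folklore] -/
theorem manhattan_stepP (p : ℤ × ℤ) : Manhattan p (stepP p) :=
  (manhattan_iff_step p _).2 (Or.inr rfl)

/-- `p → stepD p` is a Manhattan edge. [folklore] -/
theorem manhattan_stepD (p : ℤ × ℤ) : Manhattan p (stepD p) :=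
  (manhattan_iff_step p _).2 (Or.inl rfl)

/-- The two out-neighbours are distinct. [folklore] -/
theorem stepD_ne_stepP (p : ℤ × ℤ) : stepD p ≠ stepP p := by
  obtain ⟨m, n, rfl | rfl | rfl | rfl⟩ := parity_cases p <;>
    simp only [stepD_ee, stepD_eo, stepD_oe, stepD_oo, stepP_ee, stepP_eo, stepP_oe, stepP_oo,
      ne_eq, Prod.mk.injEq] <;> omega

/-- A primal step moves. [folklore] -/
theorem stepP_ne_self (p : ℤ × ℤ) : stepP p ≠ p := by
  obtain ⟨m, n, rfl | rfl | rfl | rfl⟩ := parity_cases p <;>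
    simp only [stepP_ee, stepP_eo, stepP_oe, stepP_oo, ne_eq, Prod.mk.injEq] <;> omega

/-- A dual step moves. [folklore] -/
theorem stepD_ne_self (p : ℤ × ℤ) : stepD p ≠ p := by
  obtain ⟨m, n, rfl | rfl | rfl | rfl⟩ := parity_cases p <;>
    simp only [stepD_ee, stepD_eo, stepD_oe, stepD_oo, ne_eq, Prod.mk.injEq] <;> omega

/-- **Crossing a primal edge keeps the primal neighbour.** [cite: LawlerSchrammWerner2004, §4.1] -/
@[simp] theorem primalNbr_stepP (p : ℤ × ℤ) : primalNbr (stepP p) = primalNbr p := by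
  obtain ⟨m, n, rfl | rfl | rfl | rfl⟩ := parity_cases p <;>
    simp only [stepP_ee, stepP_eo, stepP_oe, stepP_oo, primalNbr_ee, primalNbr_eo, primalNbr_oe,
      primalNbr_oo, Prod.mk.injEq, true_and, and_true] <;> omega

/-- **Crossing a dual edge keeps the dual neighbour.** [cite: LawlerSchrammWerner2004, §4.1] -/
@[simp] theorem dualNbr_stepD (p : ℤ × ℤ) : dualNbr (stepD p) = dualNbr p := by
  obtain ⟨m, n, rfl | rfl | rfl | rfl⟩ := parity_cases p <;>
    simp only [stepD_ee, stepD_eo, stepD_oe, stepD_oo, dualNbr_ee, dualNbr_eo, dualNbr_oe,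
      dualNbr_oo]

/-- The crossed primal edge `f₁` is a lattice edge at the primal neighbour. [folklore] -/
theorem latticeAdj_primalNbr_farP (p : ℤ × ℤ) : LatticeAdj (primalNbr p) (farP p) := by
  obtain ⟨m, n, rfl | rfl | rfl | rfl⟩ := parity_cases p <;> simp [LatticeAdj]

/-- The crossed dual edge `f₂` is a lattice edge at the dual neighbour. [folklore] -/
theorem latticeAdj_dualNbr_farD (p : ℤ × ℤ) : LatticeAdj (dualNbr p) (farD p) := by
  obtain ⟨m, n, rfl | rfl | rfl | rfl⟩ := parity_cases p <;> simp [LatticeAdj]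

/-- `f₁` is a genuine edge. [folklore] -/
theorem farP_ne_primalNbr (p : ℤ × ℤ) : farP p ≠ primalNbr p := by
  obtain ⟨m, n, rfl | rfl | rfl | rfl⟩ := parity_cases p <;> simp

/-- `f₂` is a genuine edge. [folklore] -/
theorem farD_ne_dualNbr (p : ℤ × ℤ) : farD p ≠ dualNbr p := by
  obtain ⟨m, n, rfl | rfl | rfl | rfl⟩ := parity_cases p <;> simp

/-! ### The co-source and the in-neighbours -/

/-- The co-source is another vertex. [folklore] -/
theorem coSrc_ne_self (p : ℤ × ℤ) : coSrc p ≠ p := by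
  obtain ⟨m, n, rfl | rfl | rfl | rfl⟩ := parity_cases p <;>
    simp only [coSrc_ee, coSrc_eo, coSrc_oe, coSrc_oo, ne_eq, Prod.mk.injEq] <;> omega

/-- The primal step of the co-source is the dual step of `p`. [folklore] -/
@[simp] theorem stepP_coSrc (p : ℤ × ℤ) : stepP (coSrc p) = stepD p := by
  obtain ⟨m, n, rfl | rfl | rfl | rfl⟩ := parity_cases p <;>
    simp only [coSrc_ee, coSrc_eo, coSrc_oe, coSrc_oo, stepP_ee, stepP_eo, stepP_oe, stepP_oo,
      stepD_ee, stepD_eo, stepD_oe, stepD_oo, Prod.mk.injEq, true_and, and_true] <;> omega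

/-- The dual step of the co-source is the primal step of `p`. [folklore] -/
@[simp] theorem stepD_coSrc (p : ℤ × ℤ) : stepD (coSrc p) = stepP p := by
  obtain ⟨m, n, rfl | rfl | rfl | rfl⟩ := parity_cases p <;>
    simp only [coSrc_ee, coSrc_eo, coSrc_oe, coSrc_oo, stepP_ee, stepP_eo, stepP_oe, stepP_oo,
      stepD_ee, stepD_eo, stepD_oe, stepD_oo]

/-- The co-source has primal neighbour `farP p` … [folklore] -/
@[simp] theorem primalNbr_coSrc (p : ℤ × ℤ) : primalNbr (coSrc p) = farP p := by
  obtain ⟨m, n, rfl | rfl | rfl | rfl⟩ := parity_cases p <;>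
    simp only [coSrc_ee, coSrc_eo, coSrc_oe, coSrc_oo, primalNbr_ee, primalNbr_eo, primalNbr_oe,
      primalNbr_oo, farP_ee, farP_eo, farP_oe, farP_oo, Prod.mk.injEq, true_and, and_true] <;> omega

/-- … and crosses the same primal edge `f₁`. [folklore] -/
@[simp] theorem farP_coSrc (p : ℤ × ℤ) : farP (coSrc p) = primalNbr p := by
  obtain ⟨m, n, rfl | rfl | rfl | rfl⟩ := parity_cases p <;>
    simp only [coSrc_ee, coSrc_eo, coSrc_oe, coSrc_oo, primalNbr_ee, primalNbr_eo, primalNbr_oe,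
      primalNbr_oo, farP_ee, farP_eo, farP_oe, farP_oo, Prod.mk.injEq, true_and, and_true] <;> omega

/-- The co-source has dual neighbour `farD p` … [folklore] -/
@[simp] theorem dualNbr_coSrc (p : ℤ × ℤ) : dualNbr (coSrc p) = farD p := by
  obtain ⟨m, n, rfl | rfl | rfl | rfl⟩ := parity_cases p <;>
    simp only [coSrc_ee, coSrc_eo, coSrc_oe, coSrc_oo, dualNbr_ee, dualNbr_eo, dualNbr_oe,
      dualNbr_oo, farD_ee, farD_eo, farD_oe, farD_oo]

/-- … and crosses the same dual edge `f₂`. [folklore] -/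
@[simp] theorem farD_coSrc (p : ℤ × ℤ) : farD (coSrc p) = dualNbr p := by
  obtain ⟨m, n, rfl | rfl | rfl | rfl⟩ := parity_cases p <;>
    simp only [coSrc_ee, coSrc_eo, coSrc_oe, coSrc_oo, dualNbr_ee, dualNbr_eo, dualNbr_oe,
      dualNbr_oo, farD_ee, farD_eo, farD_oe, farD_oo, Prod.mk.injEq, true_and, and_true] <;> omega

/-- **In-degree two**: the Manhattan in-neighbours of `stepD p` are `p` and `coSrc p`.
[cite: LawlerSchrammWerner2004, §4.1] -/
theorem manhattan_to_stepD_iff (p q : ℤ × ℤ) : Manhattan q (stepD p) ↔ q = p ∨ q = coSrc p := by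
  rw [manhattan_iff_step]
  obtain ⟨m, n, rfl | rfl | rfl | rfl⟩ := parity_cases p <;>
    obtain ⟨i, j, rfl | rfl | rfl | rfl⟩ := parity_cases q <;>
      simp only [coSrc_ee, coSrc_eo, coSrc_oe, coSrc_oo, stepP_ee, stepP_eo, stepP_oe, stepP_oo,
        stepD_ee, stepD_eo, stepD_oe, stepD_oo, Prod.mk.injEq] <;> omega

/-- **In-degree two**: the Manhattan in-neighbours of `stepP p` are `p` and `coSrc p`.
[cite: LawlerSchrammWerner2004, §4.1] -/
theorem manhattan_to_stepP_iff (p q : ℤ × ℤ) : Manhattan q (stepP p) ↔ q = p ∨ q = coSrc p := by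
  rw [manhattan_iff_step]
  obtain ⟨m, n, rfl | rfl | rfl | rfl⟩ := parity_cases p <;>
    obtain ⟨i, j, rfl | rfl | rfl | rfl⟩ := parity_cases q <;>
      simp only [coSrc_ee, coSrc_eo, coSrc_oe, coSrc_oo, stepP_ee, stepP_eo, stepP_oe, stepP_oo,
        stepD_ee, stepD_eo, stepD_oe, stepD_oo, Prod.mk.injEq] <;> omega

/-- Two vertices crossing the same primal edge are equal or co-sources of each other. [folklore] -/
theorem eq_or_eq_coSrc_of_farP {p q : ℤ × ℤ}
    (h : s(primalNbr p, farP p) = s(primalNbr q, farP q)) : p = q ∨ p = coSrc q := by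
  rw [Sym2.eq_iff] at h
  obtain ⟨m, n, rfl | rfl | rfl | rfl⟩ := parity_cases p <;>
    obtain ⟨i, j, rfl | rfl | rfl | rfl⟩ := parity_cases q <;>
      simp only [coSrc_ee, coSrc_eo, coSrc_oe, coSrc_oo, primalNbr_ee, primalNbr_eo,
        primalNbr_oe, primalNbr_oo, farP_ee, farP_eo, farP_oe, farP_oo, Prod.mk.injEq] at h ⊢ <;>
        omega

/-! ### The square faces of `G` -/

/-- **The clockwise face around a primal vertex**: four primal steps return to the start.
[cite: LawlerSchrammWerner2004, §4.1] -/
theorem stepP_stepP_stepP_stepP (p : ℤ × ℤ) : stepP (stepP (stepP (stepP p))) = p := by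
  obtain ⟨m, n, rfl | rfl | rfl | rfl⟩ := parity_cases p <;>
    simp only [stepP_ee, stepP_eo, stepP_oe, stepP_oo, Prod.mk.injEq] <;> omega

/-- **The counterclockwise face around a dual vertex**: four dual steps return to the start.
[cite: LawlerSchrammWerner2004, §4.1] -/
theorem stepD_stepD_stepD_stepD (p : ℤ × ℤ) : stepD (stepD (stepD (stepD p))) = p := by
  obtain ⟨m, n, rfl | rfl | rfl | rfl⟩ := parity_cases p <;>
    simp only [stepD_ee, stepD_eo, stepD_oe, stepD_oo]

/-- The four edges of a primal face cross four distinct spokes. [folklore] -/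
theorem farP_stepP_ne (p : ℤ × ℤ) :
    farP (stepP p) ≠ farP p ∧ farP (stepP (stepP p)) ≠ farP p ∧
      farP (stepP (stepP (stepP p))) ≠ farP p := by
  obtain ⟨m, n, rfl | rfl | rfl | rfl⟩ := parity_cases p <;>
    simp only [stepP_ee, stepP_eo, stepP_oe, stepP_oo, farP_ee, farP_eo, farP_oe, farP_oo, ne_eq,
      Prod.mk.injEq] <;> omega

/-- The four edges of a dual face cross four distinct dual spokes. [folklore] -/
theorem farD_stepD_ne (p : ℤ × ℤ) :
    farD (stepD p) ≠ farD p ∧ farD (stepD (stepD p)) ≠ farD p ∧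
      farD (stepD (stepD (stepD p))) ≠ farD p := by
  obtain ⟨m, n, rfl | rfl | rfl | rfl⟩ := parity_cases p <;>
    simp only [stepD_ee, stepD_eo, stepD_oe, stepD_oo, farD_ee, farD_eo, farD_oe, farD_oo, ne_eq,
      Prod.mk.injEq] <;> omega

/-- The corners of a primal face other than `p` are not `p`. [folklore] -/
theorem stepP_iter_ne_self (p : ℤ × ℤ) :
    stepP p ≠ p ∧ stepP (stepP p) ≠ p ∧ stepP (stepP (stepP p)) ≠ p := by
  obtain ⟨m, n, rfl | rfl | rfl | rfl⟩ := parity_cases p <;>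
    simp only [stepP_ee, stepP_eo, stepP_oe, stepP_oo, ne_eq, Prod.mk.injEq] <;> omega

/-! ### Rows and columns -/

/-- Iterating the horizontal step runs along the row at constant speed `±1`. [folklore] -/
theorem hStep_iterate (p : ℤ × ℤ) (k : ℕ) :
    hStep^[k] p = (p.1 + (if p.2 % 2 = 0 then (k : ℤ) else -(k : ℤ)), p.2) := by
  induction k with
  | zero => split_ifs <;> simp
  | succ k ih =>
    rw [Function.iterate_succ_apply', ih]
    simp only [hStep]
    split_ifs <;> simp only [Prod.mk.injEq, and_true] <;> omega

/-- Iterating the vertical step runs along the column at constant speed `±1`. [folklore] -/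
theorem vStep_iterate (p : ℤ × ℤ) (k : ℕ) :
    vStep^[k] p = (p.1, p.2 + (if p.1 % 2 = 0 then -(k : ℤ) else (k : ℤ))) := by
  induction k with
  | zero => split_ifs <;> simp
  | succ k ih =>
    rw [Function.iterate_succ_apply', ih]
    simp only [vStep]
    split_ifs <;> simp only [Prod.mk.injEq, true_and] <;> omega

/-- A row does not return. [folklore] -/
theorem hStep_iterate_injective (p : ℤ × ℤ) : Function.Injective fun k : ℕ ↦ hStep^[k] p := by
  intro k l h
  simp only [hStep_iterate, Prod.mk.injEq] at h
  split_ifs at h <;> omega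

/-- A column does not return. [folklore] -/
theorem vStep_iterate_injective (p : ℤ × ℤ) : Function.Injective fun k : ℕ ↦ vStep^[k] p := by
  intro k l h
  simp only [vStep_iterate, Prod.mk.injEq] at h
  split_ifs at h <;> omega

/-- A row stays in its row, a column in its column. [folklore] -/
theorem hStep_iterate_snd (p : ℤ × ℤ) (k : ℕ) : (hStep^[k] p).2 = p.2 ∧ (vStep^[k] p).1 = p.1 := by
  rw [hStep_iterate, vStep_iterate]
  exact ⟨rfl, rfl⟩

/-- The horizontal and the vertical step are the two steps. [folklore] -/
theorem hStep_eq_or (p : ℤ × ℤ) :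
    (hStep p = stepD p ∧ vStep p = stepP p) ∨ (hStep p = stepP p ∧ vStep p = stepD p) := by
  by_cases h : (p.1 + p.2) % 2 = 0
  · exact Or.inl ⟨by simp [stepD, h], by simp [stepP, h]⟩
  · exact Or.inr ⟨by simp [stepP, h], by simp [stepD, h]⟩

/-! ### Dual pairs -/

/-- **`f₁ ∩ f₂ ≠ ∅`**: the primal and the dual edge crossed from `p` are dual to each other.
[cite: LawlerSchrammWerner2004, §4.1] -/
theorem isDualPair_far (p : ℤ × ℤ) : IsDualPair (primalNbr p) (farP p) (dualNbr p) (farD p) := by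
  obtain ⟨m, n, rfl | rfl | rfl | rfl⟩ := parity_cases p <;>
    refine ⟨latticeAdj_primalNbr_farP _, latticeAdj_dualNbr_farD _, ?_, ?_⟩ <;>
      simp only [primalNbr_ee, primalNbr_eo, primalNbr_oe, primalNbr_oo, farP_ee, farP_eo, farP_oe,
        farP_oo, dualNbr_ee, dualNbr_eo, dualNbr_oe, dualNbr_oo, farD_ee, farD_eo, farD_oe,
        farD_oo] <;> omega

/-- `IsDualPair` is symmetric in the primal edge. [folklore] -/
theorem IsDualPair.symm_left {u u' w w' : ℤ × ℤ} (h : IsDualPair u u' w w') :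
    IsDualPair u' u w w' :=
  ⟨h.1.symm, h.2.1, by rw [← h.2.2.1]; ring, by rw [← h.2.2.2]; ring⟩

/-- `IsDualPair` is symmetric in the dual edge. [folklore] -/
theorem IsDualPair.symm_right {u u' w w' : ℤ × ℤ} (h : IsDualPair u u' w w') :
    IsDualPair u u' w' w :=
  ⟨h.1, h.2.1.symm, by rw [h.2.2.1]; ring, by rw [h.2.2.2]; ring⟩

/-- `IsDualPair` only depends on the two unordered edges. [folklore] -/
theorem isDualPair_congr {u u' v v' w w' x x' : ℤ × ℤ} (he : s(u, u') = s(v, v'))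
    (hf : s(w, w') = s(x, x')) : IsDualPair u u' w w' ↔ IsDualPair v v' x x' := by
  have key : ∀ {u u' v v' w w' : ℤ × ℤ}, s(u, u') = s(v, v') →
      IsDualPair u u' w w' → IsDualPair v v' w w' := by
    intro u u' v v' w w' he h
    rcases Sym2.eq_iff.1 he with ⟨rfl, rfl⟩ | ⟨rfl, rfl⟩
    · exact h
    · exact h.symm_left
  have key' : ∀ {u u' w w' x x' : ℤ × ℤ}, s(w, w') = s(x, x') →
      IsDualPair u u' w w' → IsDualPair u u' x x' := by
    intro u u' w w' x x' hf h
    rcases Sym2.eq_iff.1 hf with ⟨rfl, rfl⟩ | ⟨rfl, rfl⟩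
    · exact h
    · exact h.symm_right
  exact ⟨fun h ↦ key' hf (key he h), fun h ↦ key' hf.symm (key he.symm h)⟩

/-- **The dual edge determines the primal edge**: the only primal edge dual to `f₂(p)` is
`f₁(p)`. [folklore] -/
theorem IsDualPair.eq_of_dual {u u' : ℤ × ℤ} {p : ℤ × ℤ}
    (h : IsDualPair u u' (dualNbr p) (farD p)) : s(u, u') = s(primalNbr p, farP p) := by
  rw [Sym2.eq_iff]
  obtain ⟨i, j⟩ := u; obtain ⟨i', j'⟩ := u'
  obtain ⟨m, n, rfl | rfl | rfl | rfl⟩ := parity_cases p <;>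
    simp only [IsDualPair, LatticeAdj, primalNbr_ee, primalNbr_eo, primalNbr_oe, primalNbr_oo,
      farP_ee, farP_eo, farP_oe, farP_oo, dualNbr_ee, dualNbr_eo, dualNbr_oe, dualNbr_oo,
      farD_ee, farD_eo, farD_oe, farD_oo, Prod.mk.injEq] at h ⊢ <;> omega

/-- **The primal edge determines the dual edge**: the only dual edge dual to `f₁(p)` is
`f₂(p)`. [folklore] -/
theorem IsDualPair.eq_of_primal {w w' : ℤ × ℤ} {p : ℤ × ℤ}
    (h : IsDualPair (primalNbr p) (farP p) w w') : s(w, w') = s(dualNbr p, farD p) := by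
  rw [Sym2.eq_iff]
  obtain ⟨i, j⟩ := w; obtain ⟨i', j'⟩ := w'
  obtain ⟨m, n, rfl | rfl | rfl | rfl⟩ := parity_cases p <;>
    simp only [IsDualPair, LatticeAdj, primalNbr_ee, primalNbr_eo, primalNbr_oe, primalNbr_oo,
      farP_ee, farP_eo, farP_oe, farP_oo, dualNbr_ee, dualNbr_eo, dualNbr_oe, dualNbr_oo,
      farD_ee, farD_eo, farD_oe, farD_oo, Prod.mk.injEq] at h ⊢ <;> omega

/-! ### The primal/dual exchange -/

/-- `swapIdx` is an involution. [folklore] -/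
@[simp] theorem swapIdx_swapIdx (p : ℤ × ℤ) : swapIdx (swapIdx p) = p := by
  simp [swapIdx]

/-- `swapIdx` is injective. [folklore] -/
theorem swapIdx_injective : Function.Injective swapIdx :=
  Function.LeftInverse.injective swapIdx_swapIdx

/-- Components of `swapIdx`. [folklore] -/
@[simp] theorem swapIdx_fst (p : ℤ × ℤ) : (swapIdx p).1 = -p.2 := rfl

/-- Components of `swapIdx`. [folklore] -/
@[simp] theorem swapIdx_snd (p : ℤ × ℤ) : (swapIdx p).2 = -p.1 := rfl

/-- The exchange maps primal neighbours to dual neighbours. [folklore] -/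
@[simp] theorem primalNbr_swapIdx (p : ℤ × ℤ) : primalNbr (swapIdx p) = swapIdx (dualNbr p) := by
  obtain ⟨i, j⟩ := p
  simp only [primalNbr, dualNbr, swapIdx, Prod.mk.injEq]; omega

/-- The exchange maps dual neighbours to primal neighbours. [folklore] -/
@[simp] theorem dualNbr_swapIdx (p : ℤ × ℤ) : dualNbr (swapIdx p) = swapIdx (primalNbr p) := by
  obtain ⟨i, j⟩ := p
  simp only [primalNbr, dualNbr, swapIdx, Prod.mk.injEq]; omega

/-- `swapIdx` in the parity normal forms. [folklore] -/
theorem swapIdx_ee (m n : ℤ) : swapIdx (2 * m, 2 * n) = (2 * (-n), 2 * (-m)) := by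
  simp only [swapIdx, Prod.mk.injEq]; omega

/-- `swapIdx` in the parity normal forms. [folklore] -/
theorem swapIdx_eo (m n : ℤ) : swapIdx (2 * m, 2 * n + 1) = (2 * (-n - 1) + 1, 2 * (-m)) := by
  simp only [swapIdx, Prod.mk.injEq]; omega

/-- `swapIdx` in the parity normal forms. [folklore] -/
theorem swapIdx_oe (m n : ℤ) : swapIdx (2 * m + 1, 2 * n) = (2 * (-n), 2 * (-m - 1) + 1) := by
  simp only [swapIdx, Prod.mk.injEq]; omega

/-- `swapIdx` in the parity normal forms. [folklore] -/
theorem swapIdx_oo (m n : ℤ) :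
    swapIdx (2 * m + 1, 2 * n + 1) = (2 * (-n - 1) + 1, 2 * (-m - 1) + 1) := by
  simp only [swapIdx, Prod.mk.injEq]; omega

/-- The exchange maps primal steps to dual steps. [folklore] -/
@[simp] theorem stepP_swapIdx (p : ℤ × ℤ) : stepP (swapIdx p) = swapIdx (stepD p) := by
  obtain ⟨m, n, rfl | rfl | rfl | rfl⟩ := parity_cases p <;>
    simp only [swapIdx_ee, swapIdx_eo, swapIdx_oe, swapIdx_oo, stepP_ee, stepP_eo, stepP_oe,
      stepP_oo, stepD_ee, stepD_eo, stepD_oe, stepD_oo, Prod.mk.injEq, true_and, and_true] <;> omega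

/-- The exchange maps dual steps to primal steps. [folklore] -/
@[simp] theorem stepD_swapIdx (p : ℤ × ℤ) : stepD (swapIdx p) = swapIdx (stepP p) := by
  obtain ⟨m, n, rfl | rfl | rfl | rfl⟩ := parity_cases p <;>
    simp only [swapIdx_ee, swapIdx_eo, swapIdx_oe, swapIdx_oo, stepP_ee, stepP_eo, stepP_oe,
      stepP_oo, stepD_ee, stepD_eo, stepD_oe, stepD_oo, Prod.mk.injEq, true_and, and_true] <;> omega

/-- The exchange maps `farP` to `farD`. [folklore] -/
@[simp] theorem farP_swapIdx (p : ℤ × ℤ) : farP (swapIdx p) = swapIdx (farD p) := by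
  rw [farP, farD, stepD_swapIdx, primalNbr_swapIdx]

/-- The exchange maps `farD` to `farP`. [folklore] -/
@[simp] theorem farD_swapIdx (p : ℤ × ℤ) : farD (swapIdx p) = swapIdx (farP p) := by
  rw [farP, farD, stepP_swapIdx, dualNbr_swapIdx]

/-- The exchange commutes with the co-source. [folklore] -/
@[simp] theorem coSrc_swapIdx (p : ℤ × ℤ) : coSrc (swapIdx p) = swapIdx (coSrc p) := by
  obtain ⟨m, n, rfl | rfl | rfl | rfl⟩ := parity_cases p <;>
    simp only [swapIdx_ee, swapIdx_eo, swapIdx_oe, swapIdx_oo, coSrc_ee, coSrc_eo, coSrc_oe,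
      coSrc_oo, Prod.mk.injEq, true_and, and_true] <;> omega

/-- **The exchange preserves the Manhattan orientation.** [folklore] -/
theorem manhattan_swapIdx (p q : ℤ × ℤ) : Manhattan (swapIdx p) (swapIdx q) ↔ Manhattan p q := by
  rw [manhattan_iff_step, manhattan_iff_step, stepD_swapIdx, stepP_swapIdx,
    swapIdx_injective.eq_iff, swapIdx_injective.eq_iff, or_comm]

/-- The exchange preserves lattice adjacency. [folklore] -/
theorem latticeAdj_swapIdx (u v : ℤ × ℤ) : LatticeAdj (swapIdx u) (swapIdx v) ↔ LatticeAdj u v := by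
  obtain ⟨i, j⟩ := u; obtain ⟨i', j'⟩ := v
  simp only [LatticeAdj, swapIdx]; omega

/-- The exchange swaps the roles in a dual pair. [folklore] -/
theorem isDualPair_swapIdx (u u' w w' : ℤ × ℤ) :
    IsDualPair (swapIdx w) (swapIdx w') (swapIdx u) (swapIdx u') ↔ IsDualPair u u' w w' := by
  simp only [IsDualPair, latticeAdj_swapIdx, swapIdx_fst, swapIdx_snd]
  constructor
  · rintro ⟨h1, h2, h3, h4⟩
    exact ⟨h2, h1, by omega, by omega⟩
  · rintro ⟨h1, h2, h3, h4⟩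
    exact ⟨h2, h1, by omega, by omega⟩

end USTPeano

end Literature.Probability.RandomPlanarGeometry
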